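import Mathlib
import Summits.RiemannHypothesis.RiemannHypothesis.Theorems.WeilGroundStateGroundStateSimpleEvenStubPieceIntegrals
import Summits.RiemannHypothesis.RiemannHypothesis.Theorems.WeilGroundStateGroundStateSimpleEvenStubArctanLogBounds
import Literature.Analysis.SpecialFunctions.DigammaVerticalSeries
import HarnessLib

/-!
# Crux `GroundStateSimpleEven` (stmt-RiemannHypothesis-1526), line `parity-multiplicity-commutator` v3:
# the certified evaluation — closed forms and the pointwise relaxation (E-free)

Support file (`--supports stmt-RiemannHypothesis-1526`) of the lead's stub `stub_archimedeanWindows`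
(the crux on every archimedean window `0 < a ≤ (log 2)/2`, by the Fourier bathtub for the odd
sector against the parabola's Rayleigh quotient).
`E`-free calculus: the polynomial cap against `log` on `[1/100, 7/5]` and against a Lorentzian on `[0, B]` in closed form, its mass on `[0, 7/5]`, and the pointwise relaxation of the Euler–Maclaurin minorant of `Re ψ(1/4 + it/2)` into `log u − log c + const + Lorentzians`.
Everything is GENERIC in the cap `E : ℝ → ℝ`: its values on the 27 pieces (the Taylor polynomial
`2u²/3 − 2u⁴/15 + 4u⁶/315` on `(0, 7/5]`, certified constants on 24 panels with 7-smooth rational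
ends up to `16/5`, `1` on `(16/5, 47/10]`, `2` beyond, `1` at `u ≤ 0`) and its measurability are
SECTION HYPOTHESES, included where used; the cap itself is constructed once, in
`…ArchCapExists.lean`.  Generated mechanically from the certified table of the lead's folder
(`work/numerics/final_design.py`, `gen2.py`); every constant is re-checked by the kernel.
-/

noncomputable section

open Set MeasureTheory Filter
open scoped Real Topology

namespace Summit.RiemannHypothesis.RiemannHypothesis.Theorems.GroundStateSimpleEven


/-! ## Closed forms of the polynomial pieces -/

set_option linter.dupNamespace false in
/-- `∫_{1/100}^{7/5} (2u²/3 − 2u⁴/15 + 4u⁶/315) log u du` in closed form (FTC with the primitive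
`Σ c_k (u^{k+1} log u/(k+1) − u^{k+1}/(k+1)²)`). [folklore] -/
theorem arch_polyLog :
    ∫ u in (1 / 100 : ℝ)..(7 / 5), (2 / 3 * u ^ 2 - 2 / 15 * u ^ 4 + 4 / 315 * u ^ 6) * Real.log u = ((1706768 / 3515625) * Real.log (7 / 5) + (-(1870036 / 10546875))) - ((12249853001 / 55125000000000000) * Real.log (1 / 100) + (-(85749382603 / 1157625000000000000))) := by
  have key : ∀ x ∈ Set.uIcc (1 / 100 : ℝ) (7 / 5),
      HasDerivAt (fun u : ℝ ↦ 2 / 9 * (u ^ 3 * Real.log u) - 2 / 27 * u ^ 3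
        - (2 / 75 * (u ^ 5 * Real.log u) - 2 / 375 * u ^ 5)
        + (4 / 2205 * (u ^ 7 * Real.log u) - 4 / 15435 * u ^ 7))
        ((2 / 3 * x ^ 2 - 2 / 15 * x ^ 4 + 4 / 315 * x ^ 6) * Real.log x) x := by
    intro x hx
    rw [Set.uIcc_of_le (by norm_num)] at hx
    have hx0 : 0 < x := by linarith [hx.1]
    have hx1 : x ≠ 0 := hx0.ne'
    have hl := Real.hasDerivAt_log hx1
    have h3 : HasDerivAt (fun y : ℝ ↦ y ^ 3) (3 * x ^ 2) x := by simpa using hasDerivAt_pow 3 x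
    have h5 : HasDerivAt (fun y : ℝ ↦ y ^ 5) (5 * x ^ 4) x := by simpa using hasDerivAt_pow 5 x
    have h7 : HasDerivAt (fun y : ℝ ↦ y ^ 7) (7 * x ^ 6) x := by simpa using hasDerivAt_pow 7 x
    have H := ((((h3.fun_mul hl).const_mul (2 / 9 : ℝ)).fun_sub (h3.const_mul (2 / 27 : ℝ))).fun_sub
      (((h5.fun_mul hl).const_mul (2 / 75 : ℝ)).fun_sub (h5.const_mul (2 / 375 : ℝ)))).fun_add
      (((h7.fun_mul hl).const_mul (4 / 2205 : ℝ)).fun_sub (h7.const_mul (4 / 15435 : ℝ)))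
    refine H.congr_deriv ?_
    field_simp
    ring
  rw [intervalIntegral.integral_eq_sub_of_hasDerivAt key]
  · norm_num
    ring
  · exact (intervalIntegral.intervalIntegrable_log'.continuousOn_mul (by fun_prop))

set_option linter.dupNamespace false in
/-- `∫₀^{7/5} (2u²/3 − 2u⁴/15 + 4u⁶/315) du = 1706768/3515625`. [folklore] -/
theorem arch_polyMass : ∫ u in (0 : ℝ)..(7 / 5), (2 / 3 * u ^ 2 - 2 / 15 * u ^ 4 + 4 / 315 * u ^ 6) = (1706768 / 3515625) := by
  rw [intervalIntegral.integral_eq_sub_of_hasDerivAt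
    (f := fun u : ℝ ↦ 2 / 9 * u ^ 3 - 2 / 75 * u ^ 5 + 4 / 2205 * u ^ 7)
    (fun x _ ↦ by
      have h3 : HasDerivAt (fun y : ℝ ↦ y ^ 3) (3 * x ^ 2) x := by simpa using hasDerivAt_pow 3 x
      have h5 : HasDerivAt (fun y : ℝ ↦ y ^ 5) (5 * x ^ 4) x := by simpa using hasDerivAt_pow 5 x
      have h7 : HasDerivAt (fun y : ℝ ↦ y ^ 7) (7 * x ^ 6) x := by simpa using hasDerivAt_pow 7 x
      have H := ((h3.const_mul (2 / 9 : ℝ)).fun_sub (h5.const_mul (2 / 75 : ℝ))).fun_add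
        (h7.const_mul (4 / 2205 : ℝ))
      exact H.congr_deriv (by ring))
    (by apply Continuous.intervalIntegrable; fun_prop)]
  norm_num

set_option linter.dupNamespace false in
/-- The cap polynomial against a Lorentzian `C/(A + u²)` on `[0, B]` in closed form (`r² = A`):
`∫₀^B (2u²/3 − 2u⁴/15 + 4u⁶/315)·C/(A+u²) = C·(2/3·I₂ − 2/15·I₄ + 4/315·I₆)` with the moments
`I₂ = B − r arctan(B/r)`, `I₄ = B³/3 − AB + A r arctan(B/r)`, `I₆ = B⁵/5 − AB³/3 + A²B − A² r arctan(B/r)`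
(`stub_pieceIntegrals` (iv) and linearity). [folklore] -/
theorem arch_polyLorentz {A r C B : ℝ} (hr : 0 < r) (hA : r ^ 2 = A) (hB : 0 ≤ B) :
    ∫ u in (0 : ℝ)..B, (2 / 3 * u ^ 2 - 2 / 15 * u ^ 4 + 4 / 315 * u ^ 6) * (C / (A + u ^ 2)) =
      C * (2 / 3 * (B - r * Real.arctan (B / r))
        - 2 / 15 * (B ^ 3 / 3 - A * B + A * r * Real.arctan (B / r))
        + 4 / 315 * (B ^ 5 / 5 - A * B ^ 3 / 3 + A ^ 2 * B - A ^ 2 * r * Real.arctan (B / r))) := by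
  obtain ⟨-, -, -, hPI4, -⟩ := Summit.RiemannHypothesis.RiemannHypothesis.Theorems.stub_pieceIntegrals
  obtain ⟨h2, h4, h6⟩ := hPI4 A r B hr hA hB
  have hA0 : 0 < A := by rw [← hA]; positivity
  have hden : ∀ u : ℝ, A + u ^ 2 ≠ 0 := fun u ↦ by positivity
  have hc : ∀ k : ℕ, Continuous (fun u : ℝ ↦ u ^ k / (A + u ^ 2)) := fun k ↦
    Continuous.div (by fun_prop) (by fun_prop) (fun u ↦ hden u)
  have hi : ∀ k : ℕ, IntervalIntegrable (fun u : ℝ ↦ u ^ k / (A + u ^ 2)) volume 0 B :=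
    fun k ↦ (hc k).intervalIntegrable 0 B
  have e : (fun u : ℝ ↦ (2 / 3 * u ^ 2 - 2 / 15 * u ^ 4 + 4 / 315 * u ^ 6) * (C / (A + u ^ 2))) =
      fun u : ℝ ↦ C * (2 / 3) * (u ^ 2 / (A + u ^ 2)) - C * (2 / 15) * (u ^ 4 / (A + u ^ 2))
        + C * (4 / 315) * (u ^ 6 / (A + u ^ 2)) := by
    funext u
    ring
  rw [e, intervalIntegral.integral_add (((hi 2).const_mul _).sub ((hi 4).const_mul _))
      ((hi 6).const_mul _),
    intervalIntegral.integral_sub ((hi 2).const_mul _) ((hi 4).const_mul _),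
    intervalIntegral.integral_const_mul, intervalIntegral.integral_const_mul,
    intervalIntegral.integral_const_mul, h2, h4, h6]
  ring

set_option linter.dupNamespace false in
/-- **Pointwise relaxation of the Euler–Maclaurin minorant.** For `c > 0` and `u > 0`, with
`t = u/c`: `m(t) := Re ψ(1/4) + 16t²/(1+4t²) + 4t²/(5(25/4+t²)) + 2t²/(9(81/4+t²)) + log(1+4t²/81)/2`
satisfies `m(u/c) ≥ log u − log c + (Re ψ(1/4) + 4 + 4/5 + 2/9 + log 2 − 2 log 3)
  + 9c²/(9c² + u²) − (c²/(c²/4 + u²) + 5c²/(25c²/4 + u²) + (9c²/2)/(81c²/4 + u²))`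
(algebra, `log(1 + 4t²/81) = 2 log(2t/9) + log(1 + 81/(4t²))`, and the Padé bound
`log(1+y) ≥ 2y/(2+y) ≥ 2y/(9/4+y)` of `stub_arctanLogBounds`). [folklore] -/
theorem arch_minorant_relax {c u : ℝ} (hc : 0 < c) (hu : 0 < u) :
    Real.log u - Real.log c
        + (Literature.Analysis.SpecialFunctions.reDigammaQuarter 0 + 4 + 4 / 5 + 2 / 9
          + Real.log 2 - 2 * Real.log 3)
        + 9 * c ^ 2 / (9 * c ^ 2 + u ^ 2)
        - (c ^ 2 / (c ^ 2 / 4 + u ^ 2) + 5 * c ^ 2 / (25 * c ^ 2 / 4 + u ^ 2)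
          + 9 * c ^ 2 / 2 / (81 * c ^ 2 / 4 + u ^ 2)) ≤
      Literature.Analysis.SpecialFunctions.reDigammaQuarter 0 +
        16 * (u / c) ^ 2 / (1 + 4 * (u / c) ^ 2) +
        4 * (u / c) ^ 2 / (5 * (25 / 4 + (u / c) ^ 2)) +
        2 * (u / c) ^ 2 / (9 * (81 / 4 + (u / c) ^ 2)) +
        Real.log (1 + 4 * (u / c) ^ 2 / 81) / 2 := by
  obtain ⟨-, -, hPade⟩ := Summit.RiemannHypothesis.RiemannHypothesis.Theorems.stub_arctanLogBounds
  have hc2 : 0 < c ^ 2 := by positivity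
  have hu2 : 0 < u ^ 2 := by positivity
  -- the three rational terms
  have e1 : 16 * (u / c) ^ 2 / (1 + 4 * (u / c) ^ 2) = 4 - c ^ 2 / (c ^ 2 / 4 + u ^ 2) := by
    field_simp
    ring
  have e2 : 4 * (u / c) ^ 2 / (5 * (25 / 4 + (u / c) ^ 2)) = 4 / 5 - 5 * c ^ 2 / (25 * c ^ 2 / 4 + u ^ 2) := by
    field_simp
    ring
  have e3 : 2 * (u / c) ^ 2 / (9 * (81 / 4 + (u / c) ^ 2)) =
      2 / 9 - 9 * c ^ 2 / 2 / (81 * c ^ 2 / 4 + u ^ 2) := by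
    field_simp
    ring
  -- the logarithm: log(1 + 4t²/81) = 2 log(2u/(9c)) + log(1 + 81c²/(4u²))
  have hy : 0 ≤ 81 * c ^ 2 / (4 * u ^ 2) := by positivity
  have hlog : Real.log (1 + 4 * (u / c) ^ 2 / 81) =
      2 * (Real.log u - Real.log c + Real.log 2 - 2 * Real.log 3) +
        Real.log (1 + 81 * c ^ 2 / (4 * u ^ 2)) := by
    have e4 : 1 + 4 * (u / c) ^ 2 / 81 = (2 * u / (9 * c)) ^ 2 * (1 + 81 * c ^ 2 / (4 * u ^ 2)) := by
      field_simp
      ring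
    rw [e4, Real.log_mul (by positivity) (by positivity), Real.log_pow, Real.log_div (by positivity)
      (by positivity), Real.log_mul (by positivity) (by positivity), Real.log_mul (by positivity)
      (by positivity), show (9 : ℝ) = 3 ^ 2 by norm_num, Real.log_pow]
    push_cast
    ring
  have hP := hPade (81 * c ^ 2 / (4 * u ^ 2)) hy
  have hfrac : 9 * c ^ 2 / (9 * c ^ 2 + u ^ 2) =
      (81 * c ^ 2 / (4 * u ^ 2)) / (9 / 4 + 81 * c ^ 2 / (4 * u ^ 2)) := by
    field_simp
    ring
  have hmono : (81 * c ^ 2 / (4 * u ^ 2)) / (9 / 4 + 81 * c ^ 2 / (4 * u ^ 2)) ≤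
      (81 * c ^ 2 / (4 * u ^ 2)) / (2 + 81 * c ^ 2 / (4 * u ^ 2)) :=
    div_le_div_of_nonneg_left hy (by positivity) (by linarith)
  have hkey : 9 * c ^ 2 / (9 * c ^ 2 + u ^ 2) ≤ Real.log (1 + 81 * c ^ 2 / (4 * u ^ 2)) / 2 := by
    have e5 : 2 * (81 * c ^ 2 / (4 * u ^ 2)) / (2 + 81 * c ^ 2 / (4 * u ^ 2)) =
        2 * ((81 * c ^ 2 / (4 * u ^ 2)) / (2 + 81 * c ^ 2 / (4 * u ^ 2))) := by ring
    rw [hfrac]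
    linarith [hmono, hP]
  rw [e1, e2, e3, hlog]
  linarith [hkey]


end Summit.RiemannHypothesis.RiemannHypothesis.Theorems.GroundStateSimpleEven

namespace Summit.RiemannHypothesis.RiemannHypothesis.Theorems

set_option linter.dupNamespace false in
/-- **Registered sub-goal**: the closed forms of the polynomial cap against `log`, `1` and a Lorentzian. [folklore] -/
theorem stub_archClosedForms :
    (∫ u in (1 / 100 : ℝ)..(7 / 5), (2 / 3 * u ^ 2 - 2 / 15 * u ^ 4 + 4 / 315 * u ^ 6) * Real.log u =
        ((1706768 / 3515625) * Real.log (7 / 5) + (-(1870036 / 10546875))) - ((12249853001 / 55125000000000000) * Real.log (1 / 100) + (-(85749382603 / 1157625000000000000)))) ∧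
      (∫ u in (0 : ℝ)..(7 / 5), (2 / 3 * u ^ 2 - 2 / 15 * u ^ 4 + 4 / 315 * u ^ 6) = (1706768 / 3515625)) ∧
      (∀ A r C B : ℝ, 0 < r → r ^ 2 = A → 0 ≤ B →
        ∫ u in (0 : ℝ)..B, (2 / 3 * u ^ 2 - 2 / 15 * u ^ 4 + 4 / 315 * u ^ 6) * (C / (A + u ^ 2)) =
          C * (2 / 3 * (B - r * Real.arctan (B / r))
            - 2 / 15 * (B ^ 3 / 3 - A * B + A * r * Real.arctan (B / r))
            + 4 / 315 * (B ^ 5 / 5 - A * B ^ 3 / 3 + A ^ 2 * B - A ^ 2 * r * Real.arctan (B / r)))) := by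
  exact ⟨GroundStateSimpleEven.arch_polyLog, GroundStateSimpleEven.arch_polyMass,
    fun _ _ _ _ hr hA hB ↦ GroundStateSimpleEven.arch_polyLorentz hr hA hB⟩

end Summit.RiemannHypothesis.RiemannHypothesis.Theorems
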